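import Summits.Ventures.DiscreteObjects.UnitDistance.TwoPlaceZMod11Piece1
import Summits.Ventures.DiscreteObjects.UnitDistance.TwoPlaceZMod11Piece2
import Summits.Ventures.DiscreteObjects.UnitDistance.PadicHigherReduction
import HarnessLib

/-!
# `χ(unitCircleGraph (ZMod 11 × ZMod 11)) = 5` in the kernel — no two-place 11-adic 4-colouring (cell `pub-namedobj`, (U), seat udg g25)

Framing (verbatim for the cell): lottery ticket; floor = certified bounds/negative ranges.

`unitCircleGraph (ZMod 11 × ZMod 11)` is the tensor square of `UD(𝔽₁₁²)` (adjacent iff adjacent in both components).  UPPER BOUND: the first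
projection `ZMod 11 × ZMod 11 →+* ZMod 11` and the kernel 5-colouring of `UD(𝔽₁₁²)` give `χ ≤ 5` (`colorable_five_zmod11Prod`).  LOWER BOUND
(`not_colorable_four_zmod11Prod`): the 425-vertex subgraph `W` of `TwoPlaceZMod11Data.lean` has no proper 4-colouring — root run of the kernel search
(`KernelColouringSearch.lean`, udg g7; soundness `KBits.search_sound`) with the 8 refuted cut states of the piece files as its `done` list
(1563 branch nodes in all).  Hence `chromaticNumber_unitCircleGraph_zmod11Prod : χ = 5` and `χ(UD(𝔽₁₁²)^×2) = χ(UD(𝔽₁₁²))`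
(`chromaticNumber_zmod11Prod_eq_zmod11`).  In print this follows from X. Zhu's fractional Hedetniemi theorem (`χ_f(G × H) = min`) and
`χ_f(UD(𝔽₁₁²)) = 121/28 > 4`, the latter resting on the independence number `28` (two exact engines in the cell, not a kernel fact); here it is a
direct kernel certificate.  CONSEQUENCE for the cell's ℚ₁₁ line (THEORY-U21 §2 / U23 §5 of HOME): for every number field `K` with two degree-one primes
above `11` — in particular `ℚ(√3,√5)` — no proper 4-colouring of the unit-distance graph of `K²` factors through reduction modulo two such primes; with
`ReductionTowerZMod121.lean` (`χ(G₂(11)) = 5`) neither does one factor through a single prime to order 2.  Nothing here is cited as new mathematics: the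
value follows from Zhu's theorem given `α = 28`; the kernel certificate and formalisation are the cell's.
-/

namespace Summit.Ventures.DiscreteObjects.UnitDistance

open SimpleGraph KBits

/-- The root run: propagate the initial forced colours, then search down to the 8 refuted cut states. -/
def t121run : Bool :=
  match propagate t121nb 200 (t121C0, t121C1, t121C2, t121C3, 2 ^ 425 - 1) with
  | none => true
  | some st => search t121nb 425 200 [t121Q1, t121Q2, t121Q3, t121Q4, t121Q5, t121Q6, t121Q7, t121Q8] 425 st

set_option maxHeartbeats 400000000 in
set_option maxRecDepth 200000 in
/-- KERNEL FACT: the root run closes (every branch dies or reaches one of the refuted cut states). -/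
theorem t121run_eq : t121run = true := by
  decide +kernel

set_option exponentiation.threshold 2048 in
/-- `unitCircleGraph (ZMod 11 × ZMod 11)` (the tensor square of `UD(𝔽₁₁²)`) is not 4-colourable (kernel): its subgraph `W` is not. -/
theorem not_colorable_four_zmod11Prod : ¬ (unitCircleGraph (ZMod 11 × ZMod 11)).Colorable 4 := by
  rintro ⟨C⟩
  have h0s : C (t121emb 0) ≠ C (t121emb 29) := C.valid (by decide)
  have h0w : C (t121emb 0) ≠ C (t121emb 8) := C.valid (by decide)
  obtain ⟨σ, hσ0, hσs, hσw⟩ : ∃ σ : Equiv.Perm (Fin 4), σ (C (t121emb 0)) = 0 ∧ σ (C (t121emb 29)) = 1 ∧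
      (σ (C (t121emb 8)) = 1 ∨ σ (C (t121emb 8)) = 2) := by
    by_cases hsw : C (t121emb 29) = C (t121emb 8)
    · obtain ⟨σ, h0, h1⟩ := exists_perm_fin4 _ _ h0s
      exact ⟨σ, h0, h1, Or.inl (by rw [← hsw, h1])⟩
    · obtain ⟨σ, h0, h1, h2⟩ := exists_perm_fin4_three _ _ _ h0s h0w hsw
      exact ⟨σ, h0, h1, Or.inr h2⟩
  let D := recolour C σ
  have hD : ∀ x, D x = σ (C x) := fun x => rfl
  let col : ℕ → ℕ := fun v => (D (t121emb v)).val
  have hP : Proper t121nb 425 col := by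
    intro v hv
    refine ⟨(D (t121emb v)).isLt, ?_⟩
    intro w hw hbit heq
    exact D.valid (t121_adj_of_testBit v w hv hw hbit) (Fin.ext heq).symm
  have hU : UBound 425 (t121C0, t121C1, t121C2, t121C3, 2 ^ 425 - 1) := by
    intro v hv
    change Nat.testBit (2 ^ 425 - 1) v = true at hv
    rw [Nat.testBit_two_pow_sub_one] at hv
    exact of_decide_eq_true hv
  have hC : Cons 425 col (t121C0, t121C1, t121C2, t121C3, 2 ^ 425 - 1) := by
    intro w hw _
    show Nat.testBit (getC t121C0 t121C1 t121C2 t121C3 (col w)) w = true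
    rw [t121_initBits w hw (col w) (hP w hw).1]
    simp only [Bool.and_eq_true, decide_eq_true_eq]
    refine ⟨⟨fun h => ?_, fun h => ?_⟩, fun h => ?_⟩
    · subst h; show (σ (C (t121emb 0))).val = 0; rw [hσ0]; rfl
    · subst h; show (σ (C (t121emb 29))).val = 1; rw [hσs]; rfl
    · subst h; show (σ (C (t121emb 8))).val = 1 ∨ (σ (C (t121emb 8))).val = 2
      rcases hσw with h | h <;> rw [h]
      · exact Or.inl rfl
      · exact Or.inr rfl
  have hdone : ∀ d ∈ [t121Q1, t121Q2, t121Q3, t121Q4, t121Q5, t121Q6, t121Q7, t121Q8], UBound 425 d → Cons 425 col d → False := by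
    intro d hd
    simp only [List.mem_cons, List.not_mem_nil, or_false] at hd
    rcases hd with rfl | rfl | rfl | rfl | rfl | rfl | rfl | rfl
    · exact t121_piece1 hP
    · exact t121_piece2 hP
    · exact t121_piece3 hP
    · exact t121_piece4 hP
    · exact t121_piece5 hP
    · exact t121_piece6 hP
    · exact t121_piece7 hP
    · exact t121_piece8 hP
  have hrun := t121run_eq
  unfold t121run at hrun
  split at hrun
  · rename_i hnone
    exact (propagate_sound hP 200 _ hU hC).1 hnone
  · rename_i st hst
    obtain ⟨hU', hC'⟩ := (propagate_sound hP 200 _ hU hC).2 st hst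
    exact search_sound hP hdone 425 st hrun hU' hC'

/-- `unitCircleGraph (ZMod 11 × ZMod 11)` is 5-colourable: project to the first factor and use the kernel 5-colouring of `UD(𝔽₁₁²)`. -/
theorem colorable_five_zmod11Prod : (unitCircleGraph (ZMod 11 × ZMod 11)).Colorable 5 :=
  unitCircleGraph_colorable_of_ringHom (RingHom.fst (ZMod 11) (ZMod 11)) unitCircleGraph_zmod11_colorable_five

/-- KERNEL: `χ(unitCircleGraph (ZMod 11 × ZMod 11)) = 5` — Hedetniemi's equality for the tensor square of `UD(𝔽₁₁²)`. -/
theorem chromaticNumber_unitCircleGraph_zmod11Prod : (unitCircleGraph (ZMod 11 × ZMod 11)).chromaticNumber = 5 := by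
  apply le_antisymm colorable_five_zmod11Prod.chromaticNumber_le
  by_contra hlt
  have hlt' : (unitCircleGraph (ZMod 11 × ZMod 11)).chromaticNumber < (4 : ℕ∞) + 1 := lt_of_not_ge hlt
  have hle : (unitCircleGraph (ZMod 11 × ZMod 11)).chromaticNumber ≤ (4 : ℕ) := Order.le_of_lt_add_one hlt'
  exact not_colorable_four_zmod11Prod (chromaticNumber_le_iff_colorable.mp hle)

/-- The tensor square has the chromatic number of its factor: `χ(UD(𝔽₁₁²) × UD(𝔽₁₁²)) = χ(UD(𝔽₁₁²))`. -/
theorem chromaticNumber_zmod11Prod_eq_zmod11 :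
    (unitCircleGraph (ZMod 11 × ZMod 11)).chromaticNumber = (unitCircleGraph (ZMod 11)).chromaticNumber := by
  rw [chromaticNumber_unitCircleGraph_zmod11Prod, chromaticNumber_unitCircleGraph_zmod11]

end Summit.Ventures.DiscreteObjects.UnitDistance
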